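/-
Copyright (c) 2026 the pub-hodgecm-mathlib formalisation cell (harness21).  Prover seat hodgecm-mathlib-LH4-p05 (g3), req620 Track A «(D-RAM) FOUR-FRAME» squad
(unit U3_Laws, (R-18) «K-ABS-R := NI2 ⊕ KMS»; (KMS) ROAD «MODULO κ-STAGE B», κ-Stage A brick (Oκ2b) = the κ-twist of ★ (O2b) p14 `…DiagonalOrbitFibreCount`;
dealer LH4-plan (g11) WORD #20; plan `F0/P3c/LH4/LH4-p05/g3/PLAN-KMS-modKappaStageB.v1`).  2026-09-04.
-/
import Summits.HodgeConjecture.HodgeConjecture.Theorems.F0P3cDyRamDiagonalOrbitFibreClassCount  -- (this seat): ★ (O2b) CLASS BY CLASS `finsum_ncard_fibre_class_eq_and_index`; brings ★ (O2b) PARTS 1–3 (LH4-p14), ★ M, ★ TorusDefs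
import Summits.HodgeConjecture.HodgeConjecture.Theorems.F0P3cDyRamDiagonalKappaCountEval      -- (this seat): `χ`-algebra under (NI2), `cosetKappa` of a coset, `kappaCount` under one coset; brings the DEFS LEAF `…KappaCountDefs` (`signChar`, `chiVec`, `cosetKappa`, `kappaCount`), ★ StrataDefs ED. 3, ★ `normSign`
import Mathlib.Tactic.FieldSimp
import HarnessLib

/-!
# Crux `H413`, line LH4 «(D-RAM) FOUR-FRAME» road — unit U3_Laws (iii), (KMS) ROAD «MODULO κ-STAGE B», κ-STAGE A brick (Oκ2b):
# THE κ-TWISTED FIBRE COUNT ALONG A UNIT-TORUS ORBIT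
# `(Σ_e χ⁰_i(e) · Σ_{M ∈ 𝒯·M₀} #{a : diag(ϖ^{a})·M is a type-tv vertex of diag(c^{e})}) · [𝒰 : S_F(M₀)] = 8 · [𝒯 : S̃(M₀)] · κ_i(M₀)`

Cell `hodgecm-mathlib` (D-0151), FLOOR 0, crux item H413 = `stmt-HodgeConjecture-24833`, route of record `HCCMUnconditional`; squad F0∕P3c∕LH4 (req618∕req620); registered stub served:
`F0P3cDyRamFourFrameU3.stub_U3_kappaModelSum` (KMS; tree `Cruxes/H413/Lines/F0_P3c_DyRamFourFrame_U3_Laws.lean` ED. 7 :407–:429).  THEOREMS ONLY (no `def`, no instance, no notation,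
no `sorry`); lane `--supports stmt-HodgeConjecture-24833` (count-neutral).

THE MATHEMATICS.  Setting of ★ (O2b) (LH4-p14, `finsum_ncard_fibre_mul_relIndex_eq_of_exists`): `σ` an isometric involution, `|ϖ| = exp(−1)` with unit avatar `ϖu`, `c` a `σ`-fixed
NON-NORM unit with the (NI2) dichotomy, `M₀` an `𝒪`-submodule with FINITE unit-torus orbit `𝒯·M₀`, a type `tv` whose polarisation fibre over `M₀` is one `S_F(M₀)`-coset (`hcoset`).
★ (O2b) steps (1)–(7) (re-exported CLASS BY CLASS in this seat's `…DiagonalOrbitFibreClassCount`) give, for each sign class `e`, that the lattices `M = diag(u)·M₀` of the orbit for which `diag(ϖu^{a})·M` is a type-tv vertex of `diag(c^{e})` for some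
(then unique, `a = a₀`) exponent form ONE translate of the `H`-orbit (`H = 𝒯 ∩ N⁻¹(S_F)`, size `[S̃-stabiliser : H]`) when `e` is GOOD (`w⁻¹c^{e} ∈ N𝒯·S_F`, `D₁ = N(ϖu^{a₀})·w`) and the
empty set otherwise; and PART 1's index identity `#good · [· : H] · [𝒰 : S_F] = 8 · [𝒯 : S̃]`.  THE NEW LINES (this file, §2 steps (8)–(9)): **`e` is good iff `e` is the `ω`-pattern
of `w·s` for some `s ∈ S_F(M₀)`** (★ `…KappaCountEval` §1b: under (NI2) the class `e` of a `σ`-fixed unit vector `x` is read off slotwise by `ω(x_j) = −1 ↔ e_j`, `ω = normSign σ`), hence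
`χ⁰_i(e) = χ_i(w)·χ_i(s)` (multiplicativity of `χ_i`, ★ `…KappaCountEval`); so `Σ_{e good} χ⁰_i(e) = #good · cosetKappa σ i (D₁·S_F)`: if `χ_i ≡ 1` on `S_F(M₀)` every term is
`χ_i(w) = χ_i(D₁)`, else the fixed-point-free involution `e ↦ e ⊕ pattern(s₀)` (`χ_i(s₀) = −1`) pairs opposite terms (`Finset.sum_involution`) and `cosetKappa = 0`; and under the
one-coset property `kappaCount σ ϖ tv i M₀ = cosetKappa σ i (D₁·S_F)` (★ `kappaCount_eq_cosetKappa_of_hcoset`).  Hence the κ-twisted fibre identity of the title; off the polarisable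
set both sides vanish (every fibre is empty, ★ (O2b) vanishing head; `kappaCount = 0`), so ONE statement serves both cases.  (R-21): the one-coset property holds at `tv = 0` on every
normalised lattice (★ `fibre_isCoset_zero`) — the use (Oκ2c)₀ makes of this file — and FAILS on the glued type-2 strata with `ρ` even (LH4-p09 (g2)); the multiplicity version
(Oκ2b)-MULT (no `hcoset`) is a separate file on top of LH4-p14's (O2b)-MULT.
Downstream: (Oκ2c)₀ `…DiagonalKappaOrbitCount` (signed averaging engine + re-index, type 0 unconditional), then the (KMS) reduction head `…KappaModelSumOfKappaStageB`.

WHAT IS PROVED (`N = 3`; `K : Type` with `Valued K ℤᵐ⁰` — `Type`, not `Type*`, because ★ `normSign` is stated there).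
* HEAD `sum_signChar_mul_finsum_ncard_fibre_mul_relIndex_eq` — the identity of the title, for every `M₀` with finite orbit and the one-coset property, polarisable or not
  (the `ω`-pattern lemmas `normSign_apply_iff_of_mul_inv_mem_map` ∕ `mul_inv_mem_map_of_normSign_iff` it uses are §1b of `…DiagonalKappaCountEval`).
HONEST LABEL.  Count-neutral (`--supports`); nothing printed is asserted; (KMS) stays a PROVER TARGET (empirical census law in diagonal-model currency); `HC_CM` is proved only modulo
the 7 printed citations (2 remaining named inputs: hLiu418 = `stmt-HodgeConjecture-24832`, h413 = `stmt-HodgeConjecture-24833`) until rung 0 closes.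

## References
* [Kottwitz1986BaseChangeUnits] R. E. Kottwitz, *Base change for unit elements of Hecke algebras*, Compositio Math. 60 (1986), §1 pp. 240–241 (κ-orbital integrals of units as signed
  lattice counts modulo the torus).
* [Rogawski1990] J. D. Rogawski, *Automorphic Representations of Unitary Groups in Three Variables*, Ann. of Math. Stud. 123 (1990), §4.9 Prop. 4.9.1 (a) p. 55, §4.10 p. 58.
* [LanglandsShelstad1987] R. P. Langlands, D. Shelstad, *On the definition of transfer factors*, Math. Ann. 278 (1987), §3 (κ on `H¹(F, T)`).
* [Serre1979] J.-P. Serre, *Local Fields*, GTM 67 (1979), Ch. V §3 (norm classes of units).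
-/

set_option autoImplicit false

noncomputable section

namespace Summit.HodgeConjecture.HodgeConjecture.Cruxes.H413.F0P3cDyRamDiagonalKappaOrbitFibreCount

open Matrix
open Literature.NumberTheory.Automorphic Literature.NumberTheory.Automorphic.HermitianLattice
open Literature.NumberTheory.Automorphic.UnitaryLatticeTree Literature.NumberTheory.Automorphic.UnitaryThreeFourFrame
open Summit.HodgeConjecture.HodgeConjecture.Cruxes.H413.F0P3cDyRamDiagonalTorusDefs
open Summit.HodgeConjecture.HodgeConjecture.Cruxes.H413.F0P3cDyRamDiagonalOrbitFibreTransport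
open Summit.HodgeConjecture.HodgeConjecture.Cruxes.H413.F0P3cDyRamTorusRepresentativesCount
open Summit.HodgeConjecture.HodgeConjecture.Cruxes.H413.F0P3cDyRamDiagonalOrbitFibreCount
open Summit.HodgeConjecture.HodgeConjecture.Cruxes.H413.F0P3cDyRamDiagonalOrbitFibreClassCount
open Summit.HodgeConjecture.HodgeConjecture.Cruxes.H413.F0P3cDyRamDiagonalStrataDefs
open Summit.HodgeConjecture.HodgeConjecture.Cruxes.H413.F0P3cDyRamDiagonalKappaCountDefs
open Summit.HodgeConjecture.HodgeConjecture.Cruxes.H413.F0P3cDyRamDiagonalKappaCountEval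
open Summit.HodgeConjecture.HodgeConjecture.Cruxes.H413.F0P3cDyRamStableSumSignClasses (normSign_eq_one_or)
open scoped Valued WithZero Matrix MatrixGroups

variable {K : Type} [Field K] [Valued K ℤᵐ⁰]

/-! ## §1  The signed count of the good classes of one coset -/

open Classical in
/-- **THE SIGNED COUNT OF THE GOOD CLASSES OF ONE COSET.**  `c = ↑cU` a `σ`-fixed NON-NORM unit with the (NI2) dichotomy, `M₀` any `𝒪`-submodule, `D₁ = N(ϖu^{a₀})·w` a `σ`-fixed
non-degenerate vector with its unit part `w ∈ 𝒰` (★ `exists_zpow_fixedUnit_decomposition`), `i` a slot.  Call `e` GOOD when `w⁻¹c^{e} ∈ N(𝒯) ⊔ S_F(M₀)` (the classes met by the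
coset `D₁·S_F(M₀)`, ★ `…OrbitFibreClassCount`).  Then `Σ_{e good} χ⁰_i(e) = #good · cosetKappa σ i (D₁·S_F(M₀))`: `e` is good iff it is the `ω`-pattern of `w·s` for some
`s ∈ S_F(M₀)` (★ `…KappaCountEval` §1b), so `χ⁰_i(e) = χ_i(w)·χ_i(s)`; if `χ_i ≡ 1` on `S_F(M₀)` every term is `χ_i(w) = χ_i(D₁) = cosetKappa`, else the fixed-point-free
involution `e ↦ e ⊕ pattern(s₀)` (`χ_i(s₀) = −1`) pairs opposite terms and `cosetKappa = 0`.  No vertex-type or one-coset hypothesis: this is the per-coset input of both the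
one-coset fibre identity below and of its multiplicity version. [cite: Kottwitz1986BaseChangeUnits, §1 pp. 240–241] [cite: LanglandsShelstad1987, §3] -/
theorem sum_signChar_filter_good_eq_card_mul_cosetKappa {σ : K →+* K} (hvσ : ∀ a, Valued.v (σ a) = Valued.v a)
    (ϖu : Kˣ) {c : K} (hσc : σ c = c) (hcv : Valued.v c = 1) (hc : ¬ ∃ z : K, z * σ z = c)
    (hdich : ∀ x : K, σ x = x → x ≠ 0 → (∃ z : K, z * σ z = x) ∨ ∃ z : K, z * σ z = c * x) (cU : Kˣ) (hcU : (cU : K) = c)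
    (M₀ : Submodule 𝒪[K] (Fin 3 → K)) {D₁ : Fin 3 → K} (hD₁ : ∀ i, σ (D₁ i) = D₁ i ∧ D₁ i ≠ 0)
    {a₀ : Fin 3 → ℤ} {w : Fin 3 → Kˣ} (hwU : w ∈ fixedUnitTorus σ 3)
    (hD₁w : ∀ i, D₁ i = (unitNormMap σ 3 (fun j => ϖu ^ a₀ j) i : Kˣ) * (w i : Kˣ)) (i : Fin 3) :
    ∑ e ∈ Finset.univ.filter (fun e : Fin 3 → Bool =>
        w⁻¹ * (fun j => if e j then cU else 1) ∈ (unitTorus K 3).map (unitNormMap σ 3) ⊔ latticeStabilizer M₀ ⊓ fixedUnitTorus σ 3), (signChar i e : ℚ) =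
      ((Finset.univ.filter fun e : Fin 3 → Bool =>
          w⁻¹ * (fun j => if e j then cU else 1) ∈ (unitTorus K 3).map (unitNormMap σ 3) ⊔ latticeStabilizer M₀ ⊓ fixedUnitTorus σ 3).card : ℚ) *
        (cosetKappa σ i {D' : Fin 3 → K | ∃ u ∈ fixedUnitStabilizer σ M₀, ∀ j, D' j = D₁ j * ((u j : Kˣ) : K)} : ℚ) := by
  classical
  have upi : ∀ {x y : Fin 3 → Kˣ}, (∀ i, ((x i : Kˣ) : K) = y i) → x = y := fun h => funext fun i => Units.ext (h i)
  set cvec : (Fin 3 → Bool) → (Fin 3 → Kˣ) := fun e i => if e i then cU else 1 with hcvec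
  have hwU' := (mem_fixedUnitTorus_iff σ w).1 hwU
  set C₁ : Set (Fin 3 → K) := {D' : Fin 3 → K | ∃ u ∈ fixedUnitStabilizer σ M₀, ∀ j, D' j = D₁ j * ((u j : Kˣ) : K)} with hC₁
  -- Step 8 (NEW): `e` is good iff `e` is the `ω`-pattern of `w·s` for some `s ∈ S_F(M₀)`
  have hgood_pat : ∀ e, w⁻¹ * cvec e ∈ (unitTorus K 3).map (unitNormMap σ 3) ⊔ latticeStabilizer M₀ ⊓ fixedUnitTorus σ 3 ↔
      ∃ s ∈ fixedUnitStabilizer σ M₀, (w * s) * (cvec e)⁻¹ ∈ (unitTorus K 3).map (unitNormMap σ 3) := by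
    intro e
    constructor
    · intro h
      obtain ⟨y, hy, s, hs, hys⟩ := Subgroup.mem_sup.1 h
      refine ⟨s, hs, ?_⟩
      have hid : (w * s) * (cvec e)⁻¹ = s * (w⁻¹ * cvec e)⁻¹ := by
        refine upi fun j => ?_
        simp only [Pi.mul_apply, Pi.inv_apply, Units.val_mul, Units.val_inv_eq_inv_val]
        field_simp
      rw [hid, ← hys, _root_.mul_inv_rev, mul_inv_cancel_left]
      exact Subgroup.inv_mem _ hy
    · rintro ⟨s, hs, hmem⟩
      have hid : w⁻¹ * cvec e = ((w * s) * (cvec e)⁻¹)⁻¹ * s := by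
        refine upi fun j => ?_
        simp only [Pi.mul_apply, Pi.inv_apply, Units.val_mul, Units.val_inv_eq_inv_val]
        field_simp
      rw [hid]
      exact Subgroup.mul_mem _ (Subgroup.mem_sup_left (Subgroup.inv_mem _ hmem)) (Subgroup.mem_sup_right hs)
  have hsU : ∀ s ∈ fixedUnitStabilizer σ M₀, s ∈ fixedUnitTorus σ 3 := fun s hs =>
    (mem_fixedUnitTorus_iff σ s).2 ⟨((mem_fixedUnitStabilizer_iff σ M₀ s).1 hs).2.1, ((mem_fixedUnitStabilizer_iff σ M₀ s).1 hs).2.2⟩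
  have hwsfix : ∀ s ∈ fixedUnitStabilizer σ M₀, ∀ j, σ (((w * s) j : Kˣ) : K) = (w * s) j ∧ (((w * s) j : Kˣ) : K) ≠ 0 := fun s hs j =>
    ⟨((mem_fixedUnitTorus_iff σ _).1 ((fixedUnitTorus σ 3).mul_mem hwU (hsU s hs))).2 j, Units.ne_zero _⟩
  have hwfix : ∀ j, σ ((w j : Kˣ) : K) = w j ∧ ((w j : Kˣ) : K) ≠ 0 := fun j => ⟨hwU'.2 j, Units.ne_zero _⟩
  -- for a good `e`: `χ⁰_i(e) = χ_i(w)·χ_i(s)`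
  have hχgood : ∀ (e : Fin 3 → Bool), ∀ s ∈ fixedUnitStabilizer σ M₀, (w * s) * (cvec e)⁻¹ ∈ (unitTorus K 3).map (unitNormMap σ 3) →
      signChar i e = chiVec σ i (fun j => ((w j : Kˣ) : K)) * chiVec σ i (fun j => ((s j : Kˣ) : K)) := by
    intro e s hs hmem
    rw [signChar_eq_chiVec_of_pattern σ i (normSign_apply_iff_of_mul_inv_mem_map σ hc cU hcU hmem),
      ← chiVec_mul_of_dichotomy σ hσc hc hdich i hwfix (fixed_of_mem_fixedUnitStabilizer σ hs)]
    rfl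
  -- Step 9 (NEW): `Σ_{e good} χ⁰_i(e) = #good · cosetKappa (D₁·S_F)`, and `kappaCount = cosetKappa (D₁·S_F)` (one coset)
  set C₁ : Set (Fin 3 → K) := {D' : Fin 3 → K | ∃ u ∈ fixedUnitStabilizer σ M₀, ∀ j, D' j = D₁ j * ((u j : Kˣ) : K)} with hC₁
  have hχD₁ : chiVec σ i D₁ = chiVec σ i (fun j => ((w j : Kˣ) : K)) := by
    have hD₁fun : D₁ = fun j => ((w j : Kˣ) : K) * ((((ϖu ^ a₀ j : Kˣ) : K)) * σ (((ϖu ^ a₀ j : Kˣ) : K))) := by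
      funext j; rw [hD₁w j, unitNormMap_apply]; ring
    rw [hD₁fun, chiVec_mul_norm σ i _ _ (fun j => Units.ne_zero _)]
  have hsumχ : ∑ e ∈ Finset.univ.filter (fun e : Fin 3 → Bool =>
      w⁻¹ * cvec e ∈ (unitTorus K 3).map (unitNormMap σ 3) ⊔ latticeStabilizer M₀ ⊓ fixedUnitTorus σ 3), (signChar i e : ℚ) =
        ((Finset.univ.filter fun e : Fin 3 → Bool =>
          w⁻¹ * cvec e ∈ (unitTorus K 3).map (unitNormMap σ 3) ⊔ latticeStabilizer M₀ ⊓ fixedUnitTorus σ 3).card : ℚ) * (cosetKappa σ i C₁ : ℚ) := by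
    by_cases hall : ∀ s ∈ fixedUnitStabilizer σ M₀, chiVec σ i (fun j => ((s j : Kˣ) : K)) = 1
    · -- `χ_i ≡ 1` on `S_F`: every good `e` has `χ⁰_i(e) = χ_i(w) = χ_i(D₁) = cosetKappa C₁`
      rw [hC₁, cosetKappa_coset_eq_of_forall σ hσc hc hdich i M₀ hD₁ hall, hχD₁, ← nsmul_eq_mul, ← Finset.sum_const]
      refine Finset.sum_congr rfl fun e he => ?_
      obtain ⟨s, hs, hmem⟩ := (hgood_pat e).1 (Finset.mem_filter.1 he).2
      rw [hχgood e s hs hmem, hall s hs, mul_one]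
    · -- some `s₀ ∈ S_F` has `χ_i(s₀) = −1`: `cosetKappa C₁ = 0` and the involution `e ↦ e ⊕ pattern(s₀)` kills the good sum
      obtain ⟨s₀, hs₀⟩ := not_forall.1 hall
      obtain ⟨hs₀, hχs₀⟩ := Classical.not_imp.1 hs₀
      have hχs₀' : chiVec σ i (fun j => ((s₀ j : Kˣ) : K)) = -1 := (chiVec_eq_one_or σ i _).resolve_left hχs₀
      rw [hC₁, cosetKappa_coset_eq_zero_of_exists σ hσc hc hdich i M₀ hD₁ ⟨s₀, hs₀, hχs₀⟩, Int.cast_zero, mul_zero]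
      set p₀ : Fin 3 → Bool := fun j => decide (normSign σ ((s₀ j : Kˣ) : K) = -1) with hp₀
      have hp₀pat : ∀ j, p₀ j = true ↔ normSign σ ((s₀ j : Kˣ) : K) = -1 := fun j => by rw [hp₀, decide_eq_true_iff]
      have hχp₀ : signChar i p₀ = -1 := by rw [signChar_eq_chiVec_of_pattern σ i hp₀pat, hχs₀']
      have hs₀fix := fixed_of_mem_fixedUnitStabilizer σ hs₀
      -- the involution preserves goodness
      have hτgood : ∀ e, w⁻¹ * cvec e ∈ (unitTorus K 3).map (unitNormMap σ 3) ⊔ latticeStabilizer M₀ ⊓ fixedUnitTorus σ 3 →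
          w⁻¹ * cvec (fun j => xor (e j) (p₀ j)) ∈ (unitTorus K 3).map (unitNormMap σ 3) ⊔ latticeStabilizer M₀ ⊓ fixedUnitTorus σ 3 := by
        intro e he
        obtain ⟨s, hs, hmem⟩ := (hgood_pat e).1 he
        refine (hgood_pat _).2 ⟨s * s₀, mul_mem hs hs₀, ?_⟩
        have hpat := normSign_apply_iff_of_mul_inv_mem_map σ hc cU hcU hmem
        refine mul_inv_mem_map_of_normSign_iff hvσ hσc hcv hc hdich cU hcU ((fixedUnitTorus σ 3).mul_mem hwU (hsU _ (mul_mem hs hs₀))) fun j => ?_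
        have hωmul : normSign σ (((w * (s * s₀)) j : Kˣ) : K) = normSign σ (((w * s) j : Kˣ) : K) * normSign σ ((s₀ j : Kˣ) : K) := by
          rw [show (((w * (s * s₀)) j : Kˣ) : K) = (((w * s) j : Kˣ) : K) * ((s₀ j : Kˣ) : K) by
            simp only [Pi.mul_apply, Units.val_mul, mul_assoc]]
          exact normSign_mul_of_dichotomy σ hσc hc hdich (hwsfix s hs j).1 (hs₀fix j).1 (hwsfix s hs j).2 (hs₀fix j).2
        rw [hωmul]
        have key : ∀ (a b : ℤ) (x y : Bool), (a = 1 ∨ a = -1) → (b = 1 ∨ b = -1) → (x = true ↔ a = -1) → (y = true ↔ b = -1) →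
            (xor x y = true ↔ a * b = -1) := by
          rintro a b x y (rfl | rfl) (rfl | rfl) <;> cases x <;> cases y <;> decide
        exact key _ _ _ _ (normSign_eq_one_or σ _) (normSign_eq_one_or σ _) (hpat j) (hp₀pat j)
      refine Finset.sum_involution (fun e _ => fun j => xor (e j) (p₀ j)) ?_ ?_ ?_ ?_
      · intro e _
        rw [← Int.cast_add, signChar_xor, hχp₀]; simp
      · intro e _ _ heq
        have hp : p₀ = fun _ => false := by
          funext j
          have := congrFun heq j
          revert this
          cases e j <;> cases p₀ j <;> simp
        rw [hp] at hχp₀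
        revert hχp₀
        fin_cases i <;> simp [signChar_eq]
      · intro e he
        exact Finset.mem_filter.2 ⟨Finset.mem_univ _, hτgood e (Finset.mem_filter.1 he).2⟩
      · intro e _
        funext j
        rw [Bool.xor_assoc, Bool.xor_self, Bool.xor_false]
  exact hsumχ

/-! ## §2  The κ-twisted fibre count along a unit-torus orbit (one coset) -/

/-- **(Oκ2b) THE κ-TWISTED FIBRE COUNT ALONG A UNIT-TORUS ORBIT.**  `σ` an isometric involution, `|ϖ| = exp(−1)` with unit avatar `ϖu`, `c` a `σ`-fixed NON-NORM unit with the
(NI2) dichotomy, ANY `𝒪`-submodule `M₀ ≤ K³` with FINITE unit-torus orbit, `tv` any type for which the polarisation fibre over `M₀` is one `S_F(M₀)`-coset (`hcoset`, ★ B9-0 shape;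
at `tv = 0` ★ `fibre_isCoset_zero`).  Then for every slot `i`:
`(Σ_{e} χ⁰_i(e) · Σᶠ_{M ∈ 𝒯·M₀} #{a : diag(ϖu^{a})·M is a type-tv vertex of diag(d_e)}) · [𝒰 : S_F(M₀)] = 8 · [𝒯 : S̃(M₀)] · kappaCount σ ϖ tv i M₀` over `ℚ`
(`d_e j = c` if `e j` else `1`).  PROOF = ★ (O2b) steps (1)–(7) verbatim (for each `e` the lattices counted are one `H`-translate iff `e` is good, else none; PART 1's index
identity) + THE NEW STEPS (8)–(9): `e` is good iff `e` is the `ω`-pattern of `w·s` for some `s ∈ S_F(M₀)` (§1), so `χ⁰_i(e) = χ_i(w)·χ_i(s)`; if `χ_i ≡ 1` on `S_F(M₀)` the good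
sum is `#good · χ_i(w) = #good · cosetKappa(D₁·S_F)`, else the involution `e ↦ e ⊕ pattern(s₀)` (`χ_i(s₀) = −1`) kills it and `cosetKappa(D₁·S_F) = 0`; under the one-coset
property `kappaCount = cosetKappa(D₁·S_F)` (★ `kappaCount_eq_cosetKappa_of_hcoset`); off the polarisable set every fibre is empty and `kappaCount = 0`.
[cite: Kottwitz1986BaseChangeUnits, §1 pp. 240–241] [cite: Rogawski1990, §4.9 Prop. 4.9.1 (a) p. 55] [cite: LanglandsShelstad1987, §3] -/
theorem sum_signChar_mul_finsum_ncard_fibre_mul_relIndex_eq {σ : K →+* K} (hσ : ∀ x, σ (σ x) = x) (hvσ : ∀ a, Valued.v (σ a) = Valued.v a)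
    {ϖ : K} (hϖ : Valued.v ϖ = WithZero.exp (-1 : ℤ)) (ϖu : Kˣ) (hϖu : (ϖu : K) = ϖ)
    {c : K} (hσc : σ c = c) (hcv : Valued.v c = 1) (hc : ¬ ∃ z : K, z * σ z = c)
    (hdich : ∀ x : K, σ x = x → x ≠ 0 → (∃ z : K, z * σ z = x) ∨ ∃ z : K, z * σ z = c * x)
    {M₀ : Submodule 𝒪[K] (Fin 3 → K)}
    (hfin : {M : Submodule 𝒪[K] (Fin 3 → K) | ∃ u ∈ unitTorus K 3, M = mapGL (diagGLUnits u) M₀}.Finite) (tv : ℕ)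
    (hcoset : ∀ D₁ : Fin 3 → K, (∀ i, σ (D₁ i) = D₁ i ∧ D₁ i ≠ 0) → IsVertexLattice σ ϖ (Matrix.diagonal D₁) tv M₀ →
      ∀ D : Fin 3 → K, (∀ i, σ (D i) = D i ∧ D i ≠ 0) →
        (IsVertexLattice σ ϖ (Matrix.diagonal D) tv M₀ ↔ ∃ u ∈ fixedUnitStabilizer σ M₀, ∀ i, D i = D₁ i * (u i : Kˣ)))
    (i : Fin 3) :
    (∑ e : Fin 3 → Bool, (signChar i e : ℚ) *
        ((∑ᶠ M ∈ {M : Submodule 𝒪[K] (Fin 3 → K) | ∃ u ∈ unitTorus K 3, M = mapGL (diagGLUnits u) M₀},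
          ({a : Fin 3 → ℤ | IsVertexLattice σ ϖ (Matrix.diagonal fun j => if e j then c else (1 : K)) tv
            (mapGL (diagGLUnits fun j => ϖu ^ a j) M)} : Set _).ncard : ℕ) : ℚ)) *
      (((fixedUnitStabilizer σ M₀).relIndex (fixedUnitTorus σ 3) : ℕ) : ℚ) =
    8 * (((unitStabilizer M₀).relIndex (unitTorus K 3) : ℕ) : ℚ) * (kappaCount σ ϖ tv i M₀ : ℚ) := by
  classical
  have hc0 : c ≠ 0 := fun h => by simp [h] at hcv
  set Orb : Set (Submodule 𝒪[K] (Fin 3 → K)) := {M | ∃ u ∈ unitTorus K 3, M = mapGL (diagGLUnits u) M₀} with hOrb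
  -- OFF THE POLARISABLE SET: every fibre is empty, `κ_i = 0`
  by_cases hex : ∃ D₁ : Fin 3 → K, (∀ i, σ (D₁ i) = D₁ i ∧ D₁ i ≠ 0) ∧ IsVertexLattice σ ϖ (Matrix.diagonal D₁) tv M₀
  swap
  · have hzero : ∀ e : Fin 3 → Bool, (∑ᶠ M ∈ Orb, ({a : Fin 3 → ℤ |
        IsVertexLattice σ ϖ (Matrix.diagonal fun j => if e j then c else (1 : K)) tv (mapGL (diagGLUnits fun j => ϖu ^ a j) M)} : Set _).ncard) = 0 := by
      intro e
      apply finsum_mem_of_eqOn_zero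
      rintro M ⟨u, -, rfl⟩
      have hempty : ({a : Fin 3 → ℤ | IsVertexLattice σ ϖ (Matrix.diagonal fun j => if e j then c else (1 : K)) tv
          (mapGL (diagGLUnits fun j => ϖu ^ a j) (mapGL (diagGLUnits u) M₀))} : Set _) = ∅ := by
        ext a
        simp only [Set.mem_setOf_eq, Set.mem_empty_iff_false, iff_false]
        intro ha
        rw [← mapGL_mul, ← map_mul, isVertexLattice_diagonal_mapGL_diagGLUnits_iff] at ha
        refine hex ⟨_, fun j => ⟨?_, ?_⟩, ha⟩
        · have hfix : σ (if e j then c else (1 : K)) = if e j then c else 1 := by by_cases h : e j <;> simp [h, hσc]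
          rw [map_mul, map_mul, hfix, hσ, mul_comm (σ _) (_ : K)]
        · have hne' : (if e j then c else (1 : K)) ≠ 0 := by by_cases h : e j <;> simp [h, hc0]
          exact mul_ne_zero hne' (mul_ne_zero (Units.ne_zero _) ((map_ne_zero σ).2 (Units.ne_zero _)))
      change ({a : Fin 3 → ℤ | IsVertexLattice σ ϖ (Matrix.diagonal fun j => if e j then c else (1 : K)) tv
          (mapGL (diagGLUnits fun j => ϖu ^ a j) (mapGL (diagGLUnits u) M₀))} : Set _).ncard = 0
      rw [hempty, Set.ncard_empty]
    simp only [hzero, Nat.cast_zero, mul_zero, Finset.sum_const_zero, zero_mul]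
    rw [kappaCount_eq_zero_of_not_exists σ ϖ tv i M₀ hex, Int.cast_zero, mul_zero]
  obtain ⟨D₁, hD₁, hV₁⟩ := hex
  -- coordinatewise check of identities in `(K^×)³`
  have upi : ∀ {x y : Fin 3 → Kˣ}, (∀ i, ((x i : Kˣ) : K) = y i) → x = y := fun h => funext fun i => Units.ext (h i)
  set cU : Kˣ := Units.mk0 c hc0 with hcUdef
  have hcU : (cU : K) = c := rfl
  -- the decomposition `D₁ = N(ϖu^{a₀}) · w`
  obtain ⟨a₀, w, hwU, hD₁w⟩ := exists_zpow_fixedUnit_decomposition hσ hvσ hϖ ϖu hϖu hσc hcv hdich D₁ hD₁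
  have hwU' := (mem_fixedUnitTorus_iff σ w).1 hwU
  -- Steps 1–7 (★ (O2b) class by class): per-class orbit count and the index identity
  obtain ⟨hclass, hidx⟩ := finsum_ncard_fibre_class_eq_and_index hσ hvσ hϖ ϖu hϖu hσc hcv hc hdich cU hcU hfin tv hcoset hD₁ hV₁ hwU hD₁w
  set H : Subgroup (Fin 3 → Kˣ) := unitTorus K 3 ⊓ (latticeStabilizer M₀ ⊓ fixedUnitTorus σ 3).comap (unitNormMap σ 3) with hH
  -- Steps 8–9 (§1): `Σ_{e good} χ⁰_i(e) = #good · cosetKappa (D₁·S_F)`; one coset ⟹ `kappaCount = cosetKappa (D₁·S_F)`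
  set C₁ : Set (Fin 3 → K) := {D' : Fin 3 → K | ∃ u ∈ fixedUnitStabilizer σ M₀, ∀ j, D' j = D₁ j * ((u j : Kˣ) : K)} with hC₁
  have hkc : kappaCount σ ϖ tv i M₀ = cosetKappa σ i C₁ := kappaCount_eq_cosetKappa_of_hcoset σ ϖ tv i M₀ hD₁ hV₁ (hcoset D₁ hD₁ hV₁)
  have hsumχ := sum_signChar_filter_good_eq_card_mul_cosetKappa hvσ ϖu hσc hcv hc hdich cU hcU M₀ hD₁ hwU hD₁w i
  -- Step 10: assemble
  have htotal : (∑ e : Fin 3 → Bool, (signChar i e : ℚ) * ((∑ᶠ M ∈ Orb, ({a : Fin 3 → ℤ |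
      IsVertexLattice σ ϖ (Matrix.diagonal fun j => if e j then c else (1 : K)) tv (mapGL (diagGLUnits fun j => ϖu ^ a j) M)} : Set _).ncard : ℕ) : ℚ)) =
        (((latticeStabilizer M₀).relIndex H : ℕ) : ℚ) *
          (((Finset.univ.filter fun e : Fin 3 → Bool =>
              w⁻¹ * (fun j => if e j then cU else 1) ∈ (unitTorus K 3).map (unitNormMap σ 3) ⊔ latticeStabilizer M₀ ⊓ fixedUnitTorus σ 3).card : ℚ) * (cosetKappa σ i C₁ : ℚ)) := by
    rw [← hsumχ, Finset.mul_sum, Finset.sum_filter]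
    refine Finset.sum_congr rfl fun e _ => ?_
    rw [hclass e]
    split_ifs <;> simp [mul_comm]
  rw [htotal, hkc]
  have hcardQ : (((Finset.univ.filter fun e : Fin 3 → Bool =>
      w⁻¹ * (fun j => if e j then cU else 1) ∈ (unitTorus K 3).map (unitNormMap σ 3) ⊔ latticeStabilizer M₀ ⊓ fixedUnitTorus σ 3).card : ℕ) : ℚ) =
      (({e : Fin 3 → Bool | w⁻¹ * (fun j => if e j then cU else 1) ∈ (unitTorus K 3).map (unitNormMap σ 3) ⊔ latticeStabilizer M₀ ⊓ fixedUnitTorus σ 3}.ncard : ℕ) : ℚ) := by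
    rw [Set.ncard_eq_toFinset_card', Set.toFinset_setOf]
  have hidxQ : (((Finset.univ.filter fun e : Fin 3 → Bool =>
      w⁻¹ * (fun j => if e j then cU else 1) ∈ (unitTorus K 3).map (unitNormMap σ 3) ⊔ latticeStabilizer M₀ ⊓ fixedUnitTorus σ 3).card : ℕ) : ℚ) *
      (((latticeStabilizer M₀).relIndex H : ℕ) : ℚ) * (((latticeStabilizer M₀ ⊓ fixedUnitTorus σ 3).relIndex (fixedUnitTorus σ 3) : ℕ) : ℚ) =
        8 * (((latticeStabilizer M₀ ⊓ unitTorus K 3).relIndex (unitTorus K 3) : ℕ) : ℚ) := by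
    rw [hcardQ]
    exact_mod_cast hidx
  change (((latticeStabilizer M₀).relIndex H : ℕ) : ℚ) *
      ((((Finset.univ.filter fun e : Fin 3 → Bool =>
          w⁻¹ * (fun j => if e j then cU else 1) ∈ (unitTorus K 3).map (unitNormMap σ 3) ⊔ latticeStabilizer M₀ ⊓ fixedUnitTorus σ 3).card : ℕ) : ℚ) * (cosetKappa σ i C₁ : ℚ)) *
      (((latticeStabilizer M₀ ⊓ fixedUnitTorus σ 3).relIndex (fixedUnitTorus σ 3) : ℕ) : ℚ) =
    8 * (((latticeStabilizer M₀ ⊓ unitTorus K 3).relIndex (unitTorus K 3) : ℕ) : ℚ) * (cosetKappa σ i C₁ : ℚ)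
  rw [← hidxQ]
  ring

end Summit.HodgeConjecture.HodgeConjecture.Cruxes.H413.F0P3cDyRamDiagonalKappaOrbitFibreCount

end
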